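import Literature.NumberTheory.LFunctions.PrimeIdealCountDegreeOne
import HarnessLib

/-!
# Counting prime ideals above split primes: `π_L(x) ≥ [L:K] · #{split 𝔮, N𝔮 prime ≤ x}`

Topic `Literature/NumberTheory/LFunctions` (namespace `Literature.NumberTheory.LFunctions.NumberField`,
next to `PrimeIdealCountDegreeOne.lean`: `π_K(x) ≤ ∑_{p ≤ x} c_K(p) + [K:ℚ] π(√x)`,
`idealNormCount K p = c_K(p) = #{𝔞 : N𝔞 = p}`). Everything here is PROVED (theorems only).
Elementary counting used in the field-counting proof of generation of class groups by small
primes under GRH (discharge of `Literature.Computability.Cryptography.Csidh.jmv_smallPrimesGenerate`):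
if every prime `𝔮` of `K` of norm the rational prime `ℓ` has at least `n` primes of `L` above it,
all of norm `ℓ` (e.g. `𝔮` splits completely in an extension `L/K` of degree `n`), then
`c_L(ℓ) ≥ n · c_K(ℓ)`; and the degree-one part of `π_L` is `∑_{ℓ ≤ x prime} c_L(ℓ) ≤ π_L(x)`.

* `mul_idealNormCount_le_of_forall_primesOver` — `n · c_K(ℓ) ≤ c_L(ℓ)` under the hypothesis above
  (the map `(𝔮, 𝔔) ↦ 𝔔`, `𝔔` over `𝔮`, is injective since `𝔮 = 𝔔 ∩ 𝓞 K`);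
* `sum_idealNormCount_prime_le_primeIdealCount` — `∑_{ℓ ≤ x prime} c_L(ℓ) ≤ π_L(x)` (real `x ≥ 0`);
* `primeIdealCount_le_sum_idealNormCount_add_real` — the bound of `PrimeIdealCountDegreeOne` for
  real `x ≥ 0`: `π_K(x) ≤ ∑_{ℓ ≤ x prime} c_K(ℓ) + [K:ℚ] π(√x)` with `ℓ` over `Icc 0 ⌊x⌋₊`.

## References

* E. Landau, Math. Ann. 56 (1903), §13 p. 669 (`π_K(x) = ∑_{n ≤ x} G(n)`). [LandauMathAnn1903]
* P. Bürgisser, TCS 235 (2000), §4.2 p. 83 (primes of degree `> 1` are `O(√x)`). [Burgisser2000TCS]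
-/

noncomputable section

open scoped NumberField
open Finset

namespace Literature.NumberTheory.LFunctions.NumberField

variable (K L : Type*) [Field K] [NumberField K] [Field L] [NumberField L] [Algebra K L]

/-- **Primes above split primes.** If every ideal `𝔮` of `𝓞 K` of norm the prime `ℓ` has at least
`n` prime ideals of `𝓞 L` above it, each of norm `ℓ`, then `n · c_K(ℓ) ≤ c_L(ℓ)`
(`c = idealNormCount`): the pairs `(𝔮, 𝔔)` with `𝔔` above `𝔮` inject into the ideals of `𝓞 L` of
norm `ℓ` by `(𝔮, 𝔔) ↦ 𝔔`, as `𝔮 = 𝔔 ∩ 𝓞 K`. [folklore] -/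
theorem mul_idealNormCount_le_of_forall_primesOver {ℓ : ℕ} (hℓ : ℓ.Prime) {n : ℕ}
    (h : ∀ 𝔮 : Ideal (𝓞 K), Ideal.absNorm 𝔮 = ℓ →
      n ≤ (𝔮.primesOver (𝓞 L)).ncard ∧ ∀ 𝔔 ∈ 𝔮.primesOver (𝓞 L), Ideal.absNorm 𝔔 = ℓ) :
    n * idealNormCount K ℓ ≤ idealNormCount L ℓ := by
  classical
  haveI : Fact ℓ.Prime := ⟨hℓ⟩
  -- the norm-`ℓ` ideals of `𝓞 K` form a finite type
  have hfinK : Finite {𝔮 : Ideal (𝓞 K) // Ideal.absNorm 𝔮 = ℓ} :=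
    (Ideal.finite_setOf_absNorm_eq (S := 𝓞 K) ℓ).to_subtype
  haveI : Fintype {𝔮 : Ideal (𝓞 K) // Ideal.absNorm 𝔮 = ℓ} := Fintype.ofFinite _
  -- norm-`ℓ` ideals are maximal, so the sets of primes above them are finite
  have hmax : ∀ 𝔮 : Ideal (𝓞 K), Ideal.absNorm 𝔮 = ℓ → 𝔮.IsMaximal := fun 𝔮 h𝔮 =>
    ((DegreeOnePrimes.absNorm_eq_prime_iff 𝔮).1 h𝔮).1.1.isMaximal (by
      intro h0
      rw [h0, Ideal.absNorm_bot] at h𝔮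
      exact hℓ.ne_zero h𝔮.symm)
  haveI : ∀ a : {𝔮 : Ideal (𝓞 K) // Ideal.absNorm 𝔮 = ℓ}, Finite (a.1.primesOver (𝓞 L)) :=
    fun a => by
      haveI := hmax a.1 a.2
      exact (IsDedekindDomain.primesOver_finite a.1 (𝓞 L)).to_subtype
  -- the injection `(𝔮, 𝔔) ↦ 𝔔`
  let f : (Σ 𝔮 : {𝔮 : Ideal (𝓞 K) // Ideal.absNorm 𝔮 = ℓ}, (𝔮.1.primesOver (𝓞 L))) →
      {𝔔 : Ideal (𝓞 L) // Ideal.absNorm 𝔔 = ℓ} :=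
    fun x => ⟨x.2.1, (h x.1.1 x.1.2).2 x.2.1 x.2.2⟩
  have hf : Function.Injective f := by
    rintro ⟨⟨𝔮, h𝔮⟩, ⟨𝔔, h𝔔⟩⟩ ⟨⟨𝔮', h𝔮'⟩, ⟨𝔔', h𝔔'⟩⟩ hQQ
    have hQ : 𝔔 = 𝔔' := congrArg Subtype.val hQQ
    subst hQ
    have hq : 𝔮 = 𝔮' := (h𝔔.2.over : 𝔮 = _).trans (h𝔔'.2.over : 𝔮' = _).symm
    subst hq
    rfl
  have hcard := Nat.card_le_card_of_injective f hf
  rw [Nat.card_sigma] at hcard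
  rw [idealNormCount, idealNormCount]
  refine le_trans ?_ hcard
  have hsum : n * Fintype.card {𝔮 : Ideal (𝓞 K) // Ideal.absNorm 𝔮 = ℓ} =
      ∑ _a : {𝔮 : Ideal (𝓞 K) // Ideal.absNorm 𝔮 = ℓ}, n := by
    rw [sum_const, card_univ, smul_eq_mul, mul_comm]
  rw [Nat.card_eq_fintype_card, hsum]
  refine sum_le_sum fun 𝔮 _ => ?_
  rw [Nat.card_coe_set_eq]
  exact (h 𝔮.1 𝔮.2).1

/-- **The degree-one part of `π_L`**: `∑_{ℓ ≤ x prime} c_L(ℓ) ≤ π_L(x)` for real `x ≥ 0`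
(`π_L(x) = ∑_{n ≤ x} G(n)` with `G(ℓ) = c_L(ℓ)` at primes, dropping the other terms).
[cite: LandauMathAnn1903, §13 p. 669] -/
theorem sum_idealNormCount_prime_le_primeIdealCount {x : ℝ} (hx : 0 ≤ x) :
    ∑ ℓ ∈ (Icc 0 ⌊x⌋₊).filter Nat.Prime, idealNormCount L ℓ ≤ primeIdealCount L x := by
  classical
  rw [primeIdealCount_eq_sum_normPrimeIdealCount L hx,
    ← sum_filter_add_sum_filter_not (Icc 0 ⌊x⌋₊) Nat.Prime]
  refine le_trans (le_of_eq ?_) (Nat.le_add_right _ _)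
  exact sum_congr rfl fun p hp => (normPrimeIdealCount_prime L (mem_filter.mp hp).2).symm

/-- **`π_K(x) ≤ ∑_{ℓ ≤ x prime} c_K(ℓ) + [K:ℚ] π(√x)` for real `x ≥ 0`** (the tree's
`primeIdealCount_le_sum_idealNormCount_add` at `⌊x⌋₊`, with `π_K(x) = π_K(⌊x⌋₊)`).
[cite: Burgisser2000TCS, §4.2 p. 83] -/
theorem primeIdealCount_le_sum_idealNormCount_add_real {x : ℝ} (hx : 0 ≤ x) :
    primeIdealCount K x ≤ ∑ ℓ ∈ (Icc 0 ⌊x⌋₊).filter Nat.Prime, idealNormCount K ℓ +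
      Module.finrank ℚ K * Nat.primeCounting (Nat.sqrt ⌊x⌋₊) := by
  classical
  have hfloor : primeIdealCount K x = primeIdealCount K (⌊x⌋₊ : ℕ) := by
    rw [primeIdealCount_eq_sum_normPrimeIdealCount K hx,
      primeIdealCount_eq_sum_normPrimeIdealCount K (Nat.cast_nonneg _), Nat.floor_natCast]
  have hset : (Icc 0 ⌊x⌋₊).filter Nat.Prime = (range (⌊x⌋₊ + 1)).filter Nat.Prime := by
    ext p
    simp
  rw [hfloor, hset]
  exact primeIdealCount_le_sum_idealNormCount_add K ⌊x⌋₊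

end Literature.NumberTheory.LFunctions.NumberField

end
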